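import Literature.NumberTheory.LFunctions.XiIntegral
import Literature.NumberTheory.LFunctions.RiemannXiProofs
import Literature.Analysis.SpecialFunctions.GammaStirlingOrder
import Literature.NumberTheory.LFunctions.ZetaClassicalRegionBounds
import Literature.NumberTheory.LFunctions.ZetaOneLineBounds
import Literature.NumberTheory.LFunctions.SelbergMollifierProofs
import Mathlib.Analysis.Complex.HasPrimitives
import HarnessLib

/-!
# The integral of Riemann's `ξ` (Lagarias–Montague 2011): Lemma 3.3 (1) and the §5 horizontal bound — proved

Literature/NumberTheory/LFunctions, companion of `XiIntegral.lean` (definitions `xiIntegral = ξ^{(-1)}`, named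
facts of J. C. Lagarias, D. Montague, *The integral of the Riemann ξ-function*, Comment. Math. Univ. St. Pauli
60 (2011) 143–169, arXiv:1106.4348). This file DISCHARGES two of those named facts (nothing new is posited):

* `LagariasMontague2011_lem_3_3_i_holds` — **Lemma 3.3 (1)**: `|ξ(s)| ≤ C₁ e^{−π|t|/4}(|t|+1)^{5/2}` on
  `1/2 ≤ Re s ≤ 2`. The printed proof: `|½s(s−1)| = O(|t|²)`, `|π^{−s/2}| = O(1)`, Stirling
  `|Γ(s/2)| = O(e^{−π|t|/4})`, `|ζ(s)| ≤ C|t|^{1/2}`. Mathlib has no complex Stirling formula; we follow the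
  same factorisation with the tree's elementary Stirling-order bounds for `Γ` on vertical lines
  (`Literature/Analysis/SpecialFunctions/GammaStirlingOrder.lean`, plus `norm_Gamma_le_exp_of_le_half` below, from
  the reflection formula) matched, in three ranges of `σ`, with `|ζ| ≤ 9√t` (`[1/2,1)`, Titchmarsh (4.11.2)),
  `|ζ| ≤ 21 log t` (`[1,3/2)`, Titchmarsh Thm. 3.5) and `|ζ| ≤ σ/(σ−1)` (`[3/2,2]`); heights `|t| ≤ 4` by
  compactness, `t ≤ −4` by `ξ(s̄) = conj ξ(s)`. Explicit tail constant: `1344π²` (`norm_riemannXi_le_of_four_le_abs_im`).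
* `LagariasMontague2011_sec5_horizontal_holds` — **§5** (first case of the proof of Thm. 2.2):
  `|ξ^{(-1)}(σ+it) − ξ^{(-1)}(½+it)| ≤ C₄ e^{−π|t|/4}(|t|+1)^{5/2}` for `1/2 ≤ σ ≤ 2`, "from Lemma 3.3 (1) by
  integration on a horizontal line": `ξ^{(-1)} = g − g(½)` for a global primitive `g` of the entire `ξ`
  (Mathlib `Differentiable.isExactOn_univ` + FTC on the segment), so the increment is `∫_{1/2}^{σ} ξ(x+it)dx`
  (`xiIntegral_sub_eq_integral_horizontal`), of length `≤ 3/2`; `C₄ = 2C₁`.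

By `XiIntegralBridge.lean` (`Iff.rfl`) the first theorem also proves the duplicate vendored statements
`LagariasMontague2011_lemma33_1` (`XiPrimitive.lean`) and `norm_riemannXi_le_of_mem_strip_LM`
(`RiemannXiPrimitive.lean`).

## References
* J. C. Lagarias, D. Montague, *The integral of the Riemann ξ-function*, Comment. Math. Univ. St. Pauli 60
  (2011), 143–169; arXiv:1106.4348 — Lemma 3.3 (1) (p. 8), §5 (p. 13). [LagariasMontague2011]
* E. C. Titchmarsh, *The Theory of the Riemann Zeta-Function*, 2nd ed., Oxford 1986, §2.1 (2.1.12), Thm. 3.5,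
  (4.11.2), §4.12 (4.12.2). [Titchmarsh1986]
-/

noncomputable section

open Complex MeasureTheory Real Set
open _root_.Filter
open scoped _root_.Topology

namespace Literature.NumberTheory.LFunctions

/-- For `0 < x ≤ 1/2` and `|y| ≥ 1`: `‖Γ(x + iy)‖ ≤ 15π e^{−π|y|/2}` — the reflection formula
`Γ(z)Γ(1−z) = π / sin(πz)` with `‖sin(πz)‖ ≥ |sinh(πy)| ≥ e^{π|y|}/4` and the lower bound
`‖Γ(1 − z)‖ ≥ Γ(1 − x) e^{−π|y|/2} ≥ (4/15) e^{−π|y|/2}` (`1/2 ≤ 1 − x ≤ 3/2`). This is the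
Stirling-order decay `|Γ(x+iy)| ≍ |y|^{x−1/2} e^{−π|y|/2}` with the (here harmless) polynomial
factor dropped, as used for `|Γ(s/2)| = O(e^{−π|t|/4})` in Lagarias–Montague's proof of Lemma 3.3 (1).
[cite: Titchmarsh1986, §4.12 (4.12.2), consequence] -/
theorem norm_Gamma_le_exp_of_le_half {x y : ℝ} (h0 : 0 < x) (h2 : x ≤ 1 / 2) (hy : 1 ≤ |y|) :
    ‖Complex.Gamma (x + y * I)‖ ≤ 15 * π * Real.exp (-(π * |y|) / 2) := by
  have hπ := Real.pi_pos
  set z : ℂ := x + y * I with hz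
  have hrefl := Complex.Gamma_mul_Gamma_one_sub z
  have h1z : 1 - z = ((1 - x : ℝ) : ℂ) + (-y : ℝ) * I := by rw [hz]; push_cast; ring
  have hlow : 4 / 15 * Real.exp (-(π * |y|) / 2) ≤ ‖Complex.Gamma (1 - z)‖ := by
    rw [h1z]
    have h := Literature.Analysis.SpecialFunctions.norm_Gamma_ge_Gamma_mul_exp
      (x := 1 - x) (by linarith) (by linarith) (-y)
    have hG := Literature.Analysis.SpecialFunctions.Gamma_ge_four_div_fifteen
      (x := 1 - x) (by linarith) (by linarith)
    rw [abs_neg] at h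
    have hE := Real.exp_pos (-(π * |y|) / 2)
    nlinarith
  have hsin : Real.exp (π * |y|) / 4 ≤ ‖Complex.sin (π * z)‖ := by
    have h := Literature.Analysis.SpecialFunctions.abs_sinh_im_le_norm_sin (π * z)
    have him : (π * z).im = π * y := by rw [hz]; simp
    rw [him, Real.abs_sinh, abs_mul, abs_of_pos hπ] at h
    have hπ3 := Real.pi_gt_three
    have hs := Literature.Analysis.SpecialFunctions.exp_le_four_mul_sinh (u := π * |y|) (by nlinarith)
    linarith
  have hsin0 : 0 < ‖Complex.sin (π * z)‖ := lt_of_lt_of_le (by positivity) hsin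
  have hG1 : 0 < ‖Complex.Gamma (1 - z)‖ := lt_of_lt_of_le (by positivity) hlow
  have hprod : ‖Complex.Gamma z‖ * ‖Complex.Gamma (1 - z)‖ * ‖Complex.sin (π * z)‖ = π := by
    have h := congrArg norm hrefl
    rw [norm_mul, norm_div, Complex.norm_real, Real.norm_of_nonneg hπ.le] at h
    rw [h]
    field_simp
  have hE : Real.exp (-(π * |y|) / 2) * Real.exp (π * |y|) = Real.exp (π * |y| / 2) := by
    rw [← Real.exp_add]; congr 1; ring
  have hE2 : Real.exp (π * |y| / 2) * Real.exp (-(π * |y|) / 2) = 1 := by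
    rw [← Real.exp_add]; convert Real.exp_zero using 2; ring
  have hden : Real.exp (π * |y| / 2) / 15 ≤ ‖Complex.Gamma (1 - z)‖ * ‖Complex.sin (π * z)‖ := by
    calc Real.exp (π * |y| / 2) / 15
        = (4 / 15 * Real.exp (-(π * |y|) / 2)) * (Real.exp (π * |y|) / 4) := by rw [← hE]; ring
      _ ≤ ‖Complex.Gamma (1 - z)‖ * ‖Complex.sin (π * z)‖ :=
          mul_le_mul hlow hsin (by positivity) (norm_nonneg _)
  have hd0 : 0 < ‖Complex.Gamma (1 - z)‖ * ‖Complex.sin (π * z)‖ := by positivity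
  have heq : ‖Complex.Gamma z‖ = π / (‖Complex.Gamma (1 - z)‖ * ‖Complex.sin (π * z)‖) := by
    rw [eq_div_iff hd0.ne', ← mul_assoc]; exact hprod
  rw [heq, div_le_iff₀ hd0]
  calc π = 15 * π * Real.exp (-(π * |y|) / 2) * (Real.exp (π * |y| / 2) / 15) := by
        rw [show 15 * π * Real.exp (-(π * |y|) / 2) * (Real.exp (π * |y| / 2) / 15) =
          π * (Real.exp (π * |y| / 2) * Real.exp (-(π * |y|) / 2)) by ring, hE2, mul_one]
    _ ≤ 15 * π * Real.exp (-(π * |y|) / 2) * (‖Complex.Gamma (1 - z)‖ * ‖Complex.sin (π * z)‖) := by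
        gcongr

/-- **Lemma 3.3 (1) at height `t ≥ 4`, explicit**: for `1/2 ≤ σ ≤ 2` and `t ≥ 4`,
`‖ξ(σ + it)‖ ≤ 1344 π² e^{−πt/4} (t + 1)^{5/2}`. From `ξ(s) = ½ s(s−1) π^{−s/2} Γ(s/2) ζ(s)`:
`‖½ s(s−1)‖ ≤ (t+1)²`, `‖π^{−s/2}‖ ≤ 1`, and, in three ranges of `σ`, Stirling-order bounds
for `Γ(s/2)` (tree: `GammaStirlingOrder.lean`, and `norm_Gamma_le_exp_of_le_half`) against
`‖ζ(s)‖ ≤ 9√t` on `[1/2, 1)`, `≤ 21 log t` on `[1, 3/2)`, `≤ σ/(σ−1) ≤ 3` on `[3/2, 2]`.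
[cite: LagariasMontague2011, Lemma 3.3 (1)] -/
theorem norm_riemannXi_le_of_four_le_im {σ t : ℝ} (hσ : 1 / 2 ≤ σ) (hσ2 : σ ≤ 2) (ht : 4 ≤ t) :
    ‖riemannXi (σ + t * I)‖ ≤
      1344 * π ^ 2 * Real.exp (-(π / 4) * t) * (t + 1) ^ (5 / 2 : ℝ) := by
  have hπ := Real.pi_pos; have hπ3 := Real.pi_gt_three
  set s : ℂ := σ + t * I with hs
  have hsre : s.re = σ := by simp [hs]
  have hsim : s.im = t := by simp [hs]
  have ht0 : 0 < t := by linarith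
  have hσ0 : 0 < σ := by linarith
  have ht1 : 1 ≤ t + 1 := by linarith
  have hs0 : s ≠ 0 := fun h => by
    have := congrArg Complex.im h; rw [hsim] at this; simp at this; linarith
  have hs1 : s ≠ 1 := fun h => by
    have := congrArg Complex.im h; rw [hsim] at this; simp at this; linarith
  -- the factorisation `ξ(s) = ½ s(s−1) · π^{−s/2} Γ(s/2) ζ(s)`
  have hΛ : completedRiemannZeta s = Gammaℝ s * riemannZeta s := by
    rw [riemannZeta_def_of_ne_zero hs0]
    field_simp [Gammaℝ_ne_zero_of_re_pos (s := s) (by rw [hsre]; exact hσ0)]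
  have hξ : riemannXi s =
      s * (s - 1) / 2 * ((Real.pi : ℂ) ^ (-s / 2) * Complex.Gamma (s / 2) * riemannZeta s) := by
    rw [riemannXi_eq_mul_completedRiemannZeta hs0 hs1, hΛ, Gammaℝ_def]
  have hns : ‖s‖ ≤ t + 2 := by
    calc ‖s‖ ≤ |s.re| + |s.im| := Complex.norm_le_abs_re_add_abs_im s
      _ = σ + t := by rw [hsre, hsim, abs_of_pos hσ0, abs_of_pos ht0]
      _ ≤ t + 2 := by linarith
  have hns1 : ‖s - 1‖ ≤ t + 1 := by
    calc ‖s - 1‖ ≤ |(s - 1).re| + |(s - 1).im| := Complex.norm_le_abs_re_add_abs_im _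
      _ ≤ t + 1 := by
          rw [Complex.sub_re, Complex.sub_im, Complex.one_re, Complex.one_im, hsre, hsim, sub_zero,
            abs_of_pos ht0]
          have : |σ - 1| ≤ 1 := abs_le.2 ⟨by linarith, by linarith⟩
          linarith
  have hquad : ‖s * (s - 1) / 2‖ ≤ (t + 1) ^ 2 := by
    rw [norm_div, norm_mul, Complex.norm_two]
    have : ‖s‖ * ‖s - 1‖ ≤ (t + 2) * (t + 1) :=
      mul_le_mul hns hns1 (norm_nonneg _) (by linarith)
    nlinarith
  have hpi : ‖(Real.pi : ℂ) ^ (-s / 2)‖ ≤ 1 := by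
    rw [Complex.norm_cpow_eq_rpow_re_of_pos Real.pi_pos]
    refine Real.rpow_le_one_of_one_le_of_nonpos (by linarith) ?_
    have : (-s / 2).re = -s.re / 2 := by simp [neg_div]
    rw [this, hsre]
    linarith
  have hs2 : s / 2 = ((σ / 2 : ℝ) : ℂ) + ((t / 2 : ℝ) : ℂ) * I := by rw [hs]; push_cast; ring
  have hy : 1 ≤ |t / 2| := by rw [abs_of_pos (by linarith)]; linarith
  have habs : |t / 2| = t / 2 := abs_of_pos (by linarith)
  have hexp : Real.exp (-(π * |t / 2|) / 2) = Real.exp (-(π / 4) * t) := by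
    rw [habs]; congr 1; ring
  set E : ℝ := Real.exp (-(π / 4) * t) with hE
  have hE0 : 0 < E := Real.exp_pos _
  have hbase : 1 + |t / 2| ≤ t + 1 := by rw [habs]; linarith
  have hbase1 : 1 ≤ 1 + |t / 2| := by rw [habs]; linarith
  have hsqrt : Real.sqrt t ≤ (t + 1) ^ (1 / 2 : ℝ) := by
    rw [Real.sqrt_eq_rpow]
    exact Real.rpow_le_rpow ht0.le (by linarith) (by norm_num)
  have hlog : Real.log t ≤ 4 * (t + 1) ^ (1 / 4 : ℝ) := by
    have h := Real.log_le_rpow_div ht0.le (by norm_num : (0:ℝ) < 1 / 4)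
    have h' : t ^ (1 / 4 : ℝ) ≤ (t + 1) ^ (1 / 4 : ℝ) :=
      Real.rpow_le_rpow ht0.le (by linarith) (by norm_num)
    calc Real.log t ≤ t ^ (1 / 4 : ℝ) / (1 / 4) := h
      _ = 4 * t ^ (1 / 4 : ℝ) := by ring
      _ ≤ 4 * (t + 1) ^ (1 / 4 : ℝ) := by linarith
  have hquarter : (t + 1) ^ (1 / 4 : ℝ) * (t + 1) ^ (1 / 4 : ℝ) = (t + 1) ^ (1 / 2 : ℝ) := by
    rw [← Real.rpow_add (by linarith)]; norm_num
  -- the key product bound `‖Γ(s/2)‖‖ζ(s)‖ ≤ 1344π²(t+1)^{1/2}e^{−πt/4}`, in three ranges of `σ`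
  have hGZ : ‖Complex.Gamma (s / 2)‖ * ‖riemannZeta s‖ ≤ 1344 * π ^ 2 * (t + 1) ^ (1 / 2 : ℝ) * E := by
    have hr0 : 0 ≤ (t + 1) ^ (1 / 2 : ℝ) := by positivity
    rcases lt_or_ge σ 1 with hσ1 | hσ1
    · -- `1/2 ≤ σ < 1`: `‖Γ(s/2)‖ ≤ 15π E`, `‖ζ(s)‖ ≤ 9 √t`
      have hG : ‖Complex.Gamma (s / 2)‖ ≤ 15 * π * E := by
        rw [hs2, ← hexp]
        exact norm_Gamma_le_exp_of_le_half (by linarith) (by linarith) hy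
      have hZ : ‖riemannZeta s‖ ≤ 9 * (t + 1) ^ (1 / 2 : ℝ) := by
        have h := Literature.NumberTheory.LFunctions.SelbergMollifier.norm_riemannZeta_le_sqrt
          hσ hσ2 (by linarith : (2:ℝ) ≤ t)
        rw [← hs] at h
        linarith
      calc ‖Complex.Gamma (s / 2)‖ * ‖riemannZeta s‖ ≤ (15 * π * E) * (9 * (t + 1) ^ (1 / 2 : ℝ)) :=
            mul_le_mul hG hZ (norm_nonneg _) (by positivity)
        _ = 135 * π * (t + 1) ^ (1 / 2 : ℝ) * E := by ring
        _ ≤ 1344 * π ^ 2 * (t + 1) ^ (1 / 2 : ℝ) * E := by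
            have : 135 * π ≤ 1344 * π ^ 2 := by nlinarith
            have h0 : 0 ≤ (t + 1) ^ (1 / 2 : ℝ) * E := by positivity
            nlinarith
    rcases lt_or_ge σ (3 / 2) with hσ3 | hσ3
    · -- `1 ≤ σ < 3/2`: `‖Γ(s/2)‖ ≤ 16π² (t+1)^{1/4} E`, `‖ζ(s)‖ ≤ 21 log t ≤ 84 (t+1)^{1/4}`
      have hG : ‖Complex.Gamma (s / 2)‖ ≤ 16 * π ^ 2 * (t + 1) ^ (1 / 4 : ℝ) * E := by
        rw [hs2, ← hexp]
        refine (Literature.Analysis.SpecialFunctions.norm_Gamma_le_exp_of_half_le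
          (x := σ / 2) (y := t / 2) (by linarith) (by linarith) hy).trans ?_
        have h1 : (1 + |t / 2|) ^ (σ / 2 - 1 / 2) ≤ (1 + |t / 2|) ^ (1 / 4 : ℝ) :=
          Real.rpow_le_rpow_of_exponent_le hbase1 (by linarith)
        have h2 : (1 + |t / 2|) ^ (1 / 4 : ℝ) ≤ (t + 1) ^ (1 / 4 : ℝ) :=
          Real.rpow_le_rpow (by positivity) hbase (by norm_num)
        have hE' := Real.exp_pos (-(π * |t / 2|) / 2)
        gcongr
        exact h1.trans h2
      have hZ : ‖riemannZeta s‖ ≤ 84 * (t + 1) ^ (1 / 4 : ℝ) := by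
        have htabs : 3 ≤ |s.im| := by rw [hsim, abs_of_pos ht0]; linarith
        have hlogpos : 0 < Real.log |s.im| := by
          rw [hsim, abs_of_pos ht0]; exact Real.log_pos (by linarith)
        have hσ' : 1 - 1 / (2 * Real.log |s.im|) ≤ s.re := by
          rw [hsre]
          have : 0 ≤ 1 / (2 * Real.log |s.im|) := by positivity
          linarith
        have h := Literature.NumberTheory.LFunctions.ZetaOneLine.norm_riemannZeta_le_log htabs hσ'
        rw [hsim, abs_of_pos ht0] at h
        linarith
      calc ‖Complex.Gamma (s / 2)‖ * ‖riemannZeta s‖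
          ≤ (16 * π ^ 2 * (t + 1) ^ (1 / 4 : ℝ) * E) * (84 * (t + 1) ^ (1 / 4 : ℝ)) :=
            mul_le_mul hG hZ (norm_nonneg _) (by positivity)
        _ = 1344 * π ^ 2 * ((t + 1) ^ (1 / 4 : ℝ) * (t + 1) ^ (1 / 4 : ℝ)) * E := by ring
        _ = 1344 * π ^ 2 * (t + 1) ^ (1 / 2 : ℝ) * E := by rw [hquarter]
    · -- `3/2 ≤ σ ≤ 2`: `‖Γ(s/2)‖ ≤ 16π² (t+1)^{1/2} E`, `‖ζ(s)‖ ≤ σ/(σ−1) ≤ 3`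
      have hG : ‖Complex.Gamma (s / 2)‖ ≤ 16 * π ^ 2 * (t + 1) ^ (1 / 2 : ℝ) * E := by
        rw [hs2, ← hexp]
        refine (Literature.Analysis.SpecialFunctions.norm_Gamma_le_exp
          (x := σ / 2) (y := t / 2) (by linarith) (by linarith) hy).trans ?_
        have h2 : (1 + |t / 2|) ^ (1 / 2 : ℝ) ≤ (t + 1) ^ (1 / 2 : ℝ) :=
          Real.rpow_le_rpow (by positivity) hbase (by norm_num)
        have hE' := Real.exp_pos (-(π * |t / 2|) / 2)
        gcongr
      have hZ : ‖riemannZeta s‖ ≤ 3 := by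
        have h := Literature.NumberTheory.LFunctions.ZetaClassicalRegion.norm_riemannZeta_le_of_one_lt_re
          (s := s) (by rw [hsre]; linarith)
        rw [hsre] at h
        have h3 : σ / (σ - 1) ≤ 3 := by
          rw [div_le_iff₀ (by linarith)]; linarith
        exact h.trans h3
      calc ‖Complex.Gamma (s / 2)‖ * ‖riemannZeta s‖
          ≤ (16 * π ^ 2 * (t + 1) ^ (1 / 2 : ℝ) * E) * 3 :=
            mul_le_mul hG hZ (norm_nonneg _) (by positivity)
        _ = 48 * π ^ 2 * (t + 1) ^ (1 / 2 : ℝ) * E := by ring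
        _ ≤ 1344 * π ^ 2 * (t + 1) ^ (1 / 2 : ℝ) * E := by
            have h0 : 0 ≤ π ^ 2 * (t + 1) ^ (1 / 2 : ℝ) * E := by positivity
            nlinarith
  have hsplit : (t + 1) ^ (5 / 2 : ℝ) = (t + 1) ^ 2 * (t + 1) ^ (1 / 2 : ℝ) := by
    rw [show (5 / 2 : ℝ) = 2 + 1 / 2 by norm_num, Real.rpow_add (by linarith), Real.rpow_two]
  rw [hξ, norm_mul, norm_mul, norm_mul]
  calc ‖s * (s - 1) / 2‖ * (‖(Real.pi : ℂ) ^ (-s / 2)‖ * ‖Complex.Gamma (s / 2)‖ * ‖riemannZeta s‖)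
      = ‖s * (s - 1) / 2‖ * ‖(Real.pi : ℂ) ^ (-s / 2)‖ *
          (‖Complex.Gamma (s / 2)‖ * ‖riemannZeta s‖) := by ring
    _ ≤ (t + 1) ^ 2 * 1 * (1344 * π ^ 2 * (t + 1) ^ (1 / 2 : ℝ) * E) := by
        gcongr
    _ = 1344 * π ^ 2 * E * (t + 1) ^ (5 / 2 : ℝ) := by rw [hsplit]; ring

/-- The bound of `norm_riemannXi_le_of_four_le_im` on both tails `|Im s| ≥ 4` of the strip
`1/2 ≤ Re s ≤ 2` (the lower tail by Schwarz reflection `ξ(s̄) = conj ξ(s)`).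
[cite: LagariasMontague2011, Lemma 3.3 (1)] -/
theorem norm_riemannXi_le_of_four_le_abs_im {s : ℂ} (h1 : 1 / 2 ≤ s.re) (h2 : s.re ≤ 2)
    (ht : 4 ≤ |s.im|) :
    ‖riemannXi s‖ ≤
      1344 * π ^ 2 * Real.exp (-(π / 4) * |s.im|) * (|s.im| + 1) ^ (5 / 2 : ℝ) := by
  rcases le_or_gt 0 s.im with hpos | hneg
  · rw [abs_of_nonneg hpos] at ht ⊢
    have h := norm_riemannXi_le_of_four_le_im h1 h2 ht
    rwa [Complex.re_add_im] at h
  · set s' : ℂ := (starRingEnd ℂ) s with hs'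
    have hre' : s'.re = s.re := by simp [hs']
    have him' : s'.im = -s.im := by simp [hs']
    have hξ : ‖riemannXi s‖ = ‖riemannXi s'‖ := by
      have h := riemannXi_conj_holds s'
      rw [hs', Complex.conj_conj] at h
      rw [hs', h, Complex.norm_conj]
    rw [hξ, abs_of_neg hneg]
    have ht' : 4 ≤ s'.im := by rw [him']; rw [abs_of_neg hneg] at ht; exact ht
    have h := norm_riemannXi_le_of_four_le_im (σ := s'.re) (t := s'.im)
      (by rw [hre']; exact h1) (by rw [hre']; exact h2) ht'
    rwa [Complex.re_add_im, him'] at h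

/-- `ξ` is bounded on the compact rectangle `1/2 ≤ Re s ≤ 2`, `|Im s| ≤ 4` (continuity of the
entire function `ξ`). [folklore] -/
theorem exists_bound_norm_riemannXi_low :
    ∃ M : ℝ, ∀ s : ℂ, 1 / 2 ≤ s.re → s.re ≤ 2 → |s.im| ≤ 4 → ‖riemannXi s‖ ≤ M := by
  obtain ⟨M, hM⟩ := ((isCompact_Icc (a := (1 / 2 : ℝ)) (b := 2)).reProdIm
    (isCompact_Icc (a := (-4 : ℝ)) (b := 4))).exists_bound_of_continuousOn
    differentiable_riemannXi.continuous.continuousOn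
  refine ⟨M, fun s h1 h2 ht => hM s ?_⟩
  rw [Complex.mem_reProdIm]
  exact ⟨⟨h1, h2⟩, abs_le.1 ht⟩

/-- **Lagarias–Montague 2011, Lemma 3.3 (1), discharged**: there is `C₁ > 0` with
`|ξ(s)| ≤ C₁ e^{−π|t|/4} (|t| + 1)^{5/2}` for `1/2 ≤ Re s ≤ 2` (`t = Im s`). For `|t| ≥ 4` this is
`norm_riemannXi_le_of_four_le_abs_im` (explicit constant `1344 π²`); for `|t| ≤ 4` the continuous
`ξ` is bounded by some `M` on the compact rectangle and `e^{−π|t|/4}(|t|+1)^{5/2} ≥ e^{−π}` there.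
[cite: LagariasMontague2011, Lemma 3.3 (1)] -/
theorem LagariasMontague2011_lem_3_3_i_holds : LagariasMontague2011_lem_3_3_i := by
  obtain ⟨M, hM⟩ := exists_bound_norm_riemannXi_low
  have hπ := Real.pi_pos
  set K : ℝ := 1344 * π ^ 2 with hK
  have hK0 : 0 < K := by positivity
  refine ⟨K + |M| * Real.exp π, by positivity, fun s h1 h2 => ?_⟩
  set t : ℝ := |s.im| with ht
  have ht0 : 0 ≤ t := abs_nonneg _
  have hE0 := Real.exp_pos (-(π / 4) * t)
  have hP1 : 1 ≤ (t + 1) ^ (5 / 2 : ℝ) := Real.one_le_rpow (by linarith) (by norm_num)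
  rcases le_or_gt 4 t with h4 | h4
  · have h := norm_riemannXi_le_of_four_le_abs_im h1 h2 h4
    refine h.trans ?_
    have : K ≤ K + |M| * Real.exp π := le_add_of_nonneg_right (by positivity)
    gcongr
  · have hlow := hM s h1 h2 h4.le
    have hexp : Real.exp π * Real.exp (-(π / 4) * t) ≥ 1 := by
      rw [← Real.exp_add]; exact Real.one_le_exp (by nlinarith)
    calc ‖riemannXi s‖ ≤ |M| := hlow.trans (le_abs_self M)
      _ ≤ |M| * (Real.exp π * Real.exp (-(π / 4) * t)) * (t + 1) ^ (5 / 2 : ℝ) := by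
          have h0 : 0 ≤ |M| := abs_nonneg M
          calc |M| = |M| * 1 * 1 := by ring
            _ ≤ |M| * (Real.exp π * Real.exp (-(π / 4) * t)) * (t + 1) ^ (5 / 2 : ℝ) :=
                mul_le_mul (mul_le_mul_of_nonneg_left hexp h0) hP1 zero_le_one (by positivity)
      _ = |M| * Real.exp π * Real.exp (-(π / 4) * t) * (t + 1) ^ (5 / 2 : ℝ) := by ring
      _ ≤ (K + |M| * Real.exp π) * Real.exp (-(π / 4) * t) * (t + 1) ^ (5 / 2 : ℝ) := by
          have : |M| * Real.exp π ≤ K + |M| * Real.exp π := by linarith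
          gcongr

/-! ## The horizontal increment of `ξ^{(-1)}` (Lagarias–Montague 2011, §5) -/

/-- `ξ^{(-1)}` is the increment of any global primitive of `ξ`: if `g' = ξ` on `ℂ` then
`ξ^{(-1)}(s) = g(s) − g(1/2)` (fundamental theorem of calculus along the segment `[1/2, s]`;
such a `g` exists by Mathlib's Morera/primitive theorem `Differentiable.isExactOn_univ`). [folklore] -/
theorem xiIntegral_eq_sub_of_hasDerivAt {g : ℂ → ℂ} (hg : ∀ z, HasDerivAt g (riemannXi z) z)
    (s : ℂ) : xiIntegral s = g s - g (1 / 2) := by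
  unfold xiIntegral
  rw [← intervalIntegral.integral_mul_const]
  have hderiv : ∀ u ∈ Set.uIcc (0:ℝ) 1,
      HasDerivAt (fun u : ℝ => g (1 / 2 + (u : ℂ) * (s - 1 / 2)))
        (riemannXi (1 / 2 + (u : ℂ) * (s - 1 / 2)) * (s - 1 / 2)) u := by
    intro u _
    have hinner : HasDerivAt (fun z : ℂ => 1 / 2 + z * (s - 1 / 2)) (s - 1 / 2) (u : ℂ) := by
      simpa using ((hasDerivAt_id (u : ℂ)).mul_const (s - 1 / 2)).const_add (1 / 2)
    have h := (hg (1 / 2 + (u : ℂ) * (s - 1 / 2))).comp (u : ℂ) hinner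
    exact h.comp_ofReal
  have hcont : Continuous fun u : ℝ => riemannXi (1 / 2 + (u : ℂ) * (s - 1 / 2)) * (s - 1 / 2) := by
    refine Continuous.mul ?_ continuous_const
    exact differentiable_riemannXi.continuous.comp (by fun_prop)
  rw [intervalIntegral.integral_eq_sub_of_hasDerivAt hderiv (hcont.intervalIntegrable 0 1)]
  simp

/-- **Horizontal increments of `ξ^{(-1)}` are horizontal integrals of `ξ`** (path independence):
`ξ^{(-1)}(σ + it) − ξ^{(-1)}(1/2 + it) = ∫_{1/2}^{σ} ξ(x + it) dx` — the identity
"`ξ^{(-1)}(σ₀+it) = ξ^{(-1)}(½+it) + ∫_{1/2}^{σ₀} ξ(σ+it) dσ`" opening §5 of Lagarias–Montague.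
[cite: LagariasMontague2011, §5] -/
theorem xiIntegral_sub_eq_integral_horizontal (σ t : ℝ) :
    xiIntegral (σ + t * I) - xiIntegral (1 / 2 + t * I) =
      ∫ x in (1 / 2 : ℝ)..σ, riemannXi (x + t * I) := by
  obtain ⟨g, hg⟩ := differentiable_riemannXi.isExactOn_univ
  have hg' : ∀ z, HasDerivAt g (riemannXi z) z := fun z => hg z (Set.mem_univ z)
  rw [xiIntegral_eq_sub_of_hasDerivAt hg', xiIntegral_eq_sub_of_hasDerivAt hg']
  have hderiv : ∀ x ∈ Set.uIcc (1 / 2 : ℝ) σ,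
      HasDerivAt (fun x : ℝ => g (x + t * I)) (riemannXi (x + t * I)) x := by
    intro x _
    have hinner : HasDerivAt (fun z : ℂ => z + t * I) 1 (x : ℂ) :=
      (hasDerivAt_id (x : ℂ)).add_const _
    have h := (hg' ((x : ℂ) + t * I)).comp (x : ℂ) hinner
    rw [mul_one] at h
    exact h.comp_ofReal
  have hcont : Continuous fun x : ℝ => riemannXi (x + t * I) :=
    differentiable_riemannXi.continuous.comp (by fun_prop)
  rw [intervalIntegral.integral_eq_sub_of_hasDerivAt hderiv (hcont.intervalIntegrable _ _)]
  push_cast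
  ring

/-- **Lagarias–Montague 2011, §5 (first case of the proof of Thm. 2.2), discharged**: for
`1/2 ≤ σ ≤ 2` and all real `t`,
`|ξ^{(-1)}(σ + it) − ξ^{(-1)}(1/2 + it)| ≤ C₄ e^{−π|t|/4} (|t| + 1)^{5/2}` — "which follows from
Lemma 3.3 (1) by integration on a horizontal line": the increment is `∫_{1/2}^{σ} ξ(x+it) dx`
(`xiIntegral_sub_eq_integral_horizontal`), of length `≤ 3/2`, and the integrand is bounded by
Lemma 3.3 (1) (`LagariasMontague2011_lem_3_3_i_holds`); `C₄ = 2C₁`.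
[cite: LagariasMontague2011, §5 (proof of Thm. 2.2, first case)] -/
theorem LagariasMontague2011_sec5_horizontal_holds : LagariasMontague2011_sec5_horizontal := by
  obtain ⟨C₁, hC₁, hb⟩ := LagariasMontague2011_lem_3_3_i_holds
  refine ⟨2 * C₁, by positivity, fun σ t h1 h2 => ?_⟩
  rw [xiIntegral_sub_eq_integral_horizontal]
  set B : ℝ := C₁ * Real.exp (-(Real.pi / 4) * |t|) * (|t| + 1) ^ (5 / 2 : ℝ) with hB
  have hB0 : 0 ≤ B := by positivity
  have hle : ∀ x ∈ Set.uIoc (1 / 2 : ℝ) σ, ‖riemannXi (x + t * I)‖ ≤ B := by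
    intro x hx
    rw [Set.uIoc_of_le h1] at hx
    have hxre : ((x : ℂ) + t * I).re = x := by simp
    have hxim : ((x : ℂ) + t * I).im = t := by simp
    have h := hb ((x : ℂ) + t * I) (by rw [hxre]; exact hx.1.le) (by rw [hxre]; exact hx.2.trans h2)
    rw [hxim] at h
    exact h
  calc ‖∫ x in (1 / 2 : ℝ)..σ, riemannXi (x + t * I)‖ ≤ B * |σ - 1 / 2| :=
        intervalIntegral.norm_integral_le_of_norm_le_const hle
    _ ≤ B * 2 := by
        gcongr
        rw [abs_of_nonneg (by linarith)]; linarith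
    _ = 2 * C₁ * Real.exp (-(Real.pi / 4) * |t|) * (|t| + 1) ^ (5 / 2 : ℝ) := by rw [hB]; ring

end Literature.NumberTheory.LFunctions
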